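import Summits.BirchSwinnertonDyer.Rank1Residual.X11b.CastellaErratumClassNumber
import Summits.BirchSwinnertonDyer.Rank1Residual.X11b.LocalTorsionChainLocus
import Summits.BirchSwinnertonDyer.Rank1Residual.X11b.HeegnerIdealRamified
import Literature.NumberTheory.EllipticCurves.HeegnerPointsImaginaryQuadraticProofs
import HarnessLib

/-!
# X11b, route R1 — the (c)-congruence's standing hypotheses ON THE VERSION OF RECORD of [Cas20] (query Q7): `−D_K < −3` odd, `p > 2` split, (heeg) relative to `N` prime to `p` — ALL MET by every erratum field at an odd `q`; the `p ∤ h_K` binder dropped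

HONEST FRAMING (cell `b2b-bsdres`, run/shared/lean/b2b/bsd-rank1-residual/, verbatim in every
file): the goal of the cell is to DELETE the COMBINATION-SHAPED residual classes of the
Birch–Swinnerton-Dyer formula for ALL analytic-rank `≤ 1` elliptic curves over `ℚ` — "full BSD
formula for every rank `≤ 1` curve in class `C`" assembled STRICTLY from published theorems — so
that the rank-`≤ 1` remainder becomes exactly the CONSTRUCTION-SHAPED classes, which are TYPED
(missing-input `Prop`s), NOT attempted. This is not "finishing BSD". Sub-cell
`b2b-bsdres-multr1-p1` (X11b, route R1); no claim beyond the stated class; X11b stays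
CONSTRUCTION-SHAPED; nothing here changes a label; no named fact (one `Prop`-valued predicate
with parameters, theorems; no `sorry`; no claim that any published or announced theorem is false).

## Why this file exists (query Q7 answered; referee nit `Cas20-hK-binder-superfluous`)

`CastellaErratumClassNumber.lean` (p210941) displayed, on the open input (A) of route R1, the two
running hypotheses "`D` odd, `p ∤ h_K`" under which the held arXiv text of [Cas20] (arXiv:1410.6591
**v2**, 2017, §1.2 p. 5 ll. 51–57; §3 p. 10 l. 9 "for simplicity") states the material behind the
erratum's congruence (c) "[Cas20, Thm. 2.11]". The literature seat (lit GEN 20, CITED-FACTS C85,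
READINGS-g20 R1–R5) then read the VERSION OF RECORD — F. Castella, *On the `p`-adic variation of
Heegner points*, J. Inst. Math. Jussieu 19 (2020) 2127–2164, author's accepted manuscript
(`web.math.ucsb.edu/~castella/Heegner.pdf`, 31 pp.; archived under
HOME/b2b-bsdres-lit/g20/texts/paper-url-9f86bdbf1136/) — on which the erratum's numbering
(Thm. 2.11 / Thm. 5.3 / Thm. 6.5) resolves, and found: **the words "class number" occur nowhere in
it; `p ∤ h_K` is a superseded-preprint hypothesis (arXiv v2 §1.2), absent from the version of
record** (absent also from [CH18] Hyp. (H), Prop. 3.8 and from [Hsi14] Thms. A–C, the inputs of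
Thm. 2.11's proof; in the refereed higher-weight model [CGS23, Def. 1.4.3, Prop. 1.4.5] `h_K` is a
CANCELLING FACTOR of `𝓛_p^{Gr}`, not a hypothesis). What the version of record DOES carry, verbatim:

§2.5 "CM points" (author PDF p. 8):
> "Let `K` be an imaginary quadratic field of odd discriminant `−D_K < −3`, let `p > 2` be a prime
> split in `K`, and write `p𝒪_K = 𝔭𝔭̄` … We shall assume throughout that `K` satisfies the
> following Heegner hypothesis relative to a fixed integer `N > 0` prime to `p`:
> (heeg) there is an ideal `𝔑 ⊂ 𝒪_K` with `𝒪_K/𝔑 ≃ ℤ/Nℤ`.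
> The existence of such `𝔑`, which will be fixed from now on, amounts to the requirement that
> every prime `q ∣ N` is either split or ramified in `K`, with `q² ∤ N` in the latter case."

Thm. 2.11 (author PDF p. 12; `𝐟 ∈ S^a(N, ψ₀; 𝕀)` an ordinary `𝕀`-adic newform of tame level `N`,
§2.7; `𝓛_{𝔭,ξ}(𝐟)` the two-variable anticyclotomic `p`-adic `L`-function of Def. 2.10):
> "Let `ν ∈ 𝔛_𝒪(𝕀)` of weight `(k, 1)` with `k ⩾ 1` be such that `𝐟_ν` is classical, and let `φ̂`
> be the `p`-adic avatar of an anticyclotomic Hecke character `φ` of `K` of infinity type `(ℓ, −ℓ)`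
> with `ℓ ⩾ 0` and conductor `c_o p^n 𝒪_K` with `p ∤ c_o`. Then:
> `ν(𝓛_{𝔭,ξ}(𝐟))(φ̂)² / Ω_p^{2k+4ℓ} = L^{alg}(𝐟_ν/K, χ_ν ξ_ν φ, k_ν − 1) · E_p(𝐟_ν, χ_ν ξ_ν φ)² ·
> φ(𝔑^{−1}) · 2³ · c_o ε(𝐟_ν) · w_K² √D_K`,
> where `ε(𝐟_ν)` is the global root number of `𝐟_ν`, `w_K := |𝒪_K^×|`, and `Ω_p ∈ W^×` is a `p`-adic
> period as in [CH18, §2.5]."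

(In the erratum's use, `N` is the TAME level `N_E/p` of the Hida family through `f_E` — `E` has
multiplicative reduction at `p ∥ N_E` — and the congruent forms `g_m` have "level prime to `p`".)
This file TYPES the §2.5 standing hypotheses on tree objects (`Cas20Standing K p N`, (heeg) in its
LITERAL form `∃ 𝔑, 𝓞 K ⧸ 𝔑 ≃+* ZMod N`) and PROVES that every erratum field of route R1 at an ODD
non-split ramified prime `q` meets all of them at the tame level `N_E/p`:

* `IsErratumField.discr_emod_eight` — `d_K ≡ 1 (mod 8)` (the prime `2` splits: `q ≠ 2`);
  `IsErratumField.odd_discr`; **`IsErratumField.discr_lt_neg_three`** — `d_K < −3` (indeed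
  `d_K ≤ −7`: negative and `≡ 1 (mod 8)`), so `K ≠ ℚ(√−3), ℚ(√−1)` and `w_K = 2` automatically
  (`discr_ne_neg_three`, `discr_ne_neg_four`);
* `tameLevel_pos`, `not_dvd_tameLevel`, `not_dvd_six_mul_tameLevel` — `N_E/p > 0`, `p ∤ N_E/p`
  (`p ∥ N_E`, Silverman *ATAEC* IV.10.2: the tree's `not_sq_dvd_conductorNorm_of_mult`),
  and `p ∤ 6·(N_E/p)` for `p ≥ 5` (§1's "fix a prime `p ∤ 6N`");
* **`IsErratumField.heeg_tameLevel`** — (heeg) LITERALLY at `N_E/p`: `∃ 𝔑 ⊂ 𝓞 K` with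
  `𝓞 K ⧸ 𝔑 ≃+* ZMod (N_E/p)` (every `ℓ ∣ N_E/p` other than `q` splits; `q` is ramified with
  `q ∥ N_E` — `HeegnerIdeal.exists_ideal_quotient_ringEquiv_zmod_of_split_or_ramified`);
* **`IsErratumField.cas20Standing`** — `ErratumHypotheses W p`, `q ∉ {2, p}` multiplicative,
  `IsErratumField W K q` ⟹ `Cas20Standing K p (N_E/p)`;
* the END FORMS with the display assumed ONLY where (c) is printed on the version of record —
  "(A|VoR)", over erratum fields satisfying `Cas20Standing K p (N_E/p)` — and WITHOUT any `p ∤ h_K`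
  binder or class-number supply are in the companion file `CastellaErratumVersionOfRecordEndForm.lean`
  (`forall_bsdp_of_display_versionOfRecord`: NINE published facts + (A|VoR);
  `bsdp_of_display_versionOfRecord_of_witnesses`: data level, census columns only).

What remains DISPLAYED and is genuinely printed: `D_K` odd (⟺ `q ≠ 2` on an erratum field,
`IsErratumField.not_two_dvd_discr_iff`; the erratum's Thm. 1.1 (ii) admits `2` ramified in `K`
when `2 ∥ N` — that mismatch with (c)'s standing "odd discriminant" stands and costs the `q = 2`
corner, `9.1 %` of the `ChainLocus` census). Corrected locator for p210941's citations (whose text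
"[Cas20] §2.2 running hypotheses (arXiv:1410.6591 p. 5, ll. 51–57)" quotes the superseded v2):
[Castella2020JIMJ, §2.5 (author PDF p. 8) and Thm. 2.11 (p. 12)]. Flags (referee/lit):
`Cas20-2.11-number-inferred` RETIRED, `Cas18err-(c)-oddD-hK` → `Cas18err-(c)-oddD`,
nit `Cas20-hK-binder-superfluous` answered here. CONDITIONAL on (A|VoR) ⇐ erratum Thm. 1.1 ⇐
[FW21, Thm. 4.41] (PREPRINT); deletes nothing; no label change.

References: [Castella2020JIMJ] §1 (p. 2), §2.5 (p. 8), Thm. 2.11 (p. 12) — version of record;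
[Castella2018Erratum] Thm. 1.1 and proof (p. 4) (a)–(c); [Castella2018] §5; [CastellaHsieh2018]
Hyp. (H), Prop. 3.8; Hsieh, Doc. Math. 19 (2014) Thms. A–C; [FriedbergHoffstein1995] Thm. B.
-/

noncomputable section

open scoped Classical

open WeierstrassCurve NumberField Literature.NumberTheory.EllipticCurves
  Literature.NumberTheory.EllipticCurves.ModularForms
  Literature.NumberTheory.EllipticCurves.Rank1Residual

namespace Summit.BirchSwinnertonDyer.Rank1Residual.X11b

/-! ### [Cas20, §2.5]'s standing hypotheses, typed -/

/-- **The standing hypotheses of [Cas20] §2.5 on `(K, p, N)` — version of record, VERBATIM**: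
"Let `K` be an imaginary quadratic field of odd discriminant `−D_K < −3`, let `p > 2` be a prime
split in `K` … We shall assume throughout that `K` satisfies the following Heegner hypothesis
relative to a fixed integer `N > 0` prime to `p`: (heeg) there is an ideal `𝔑 ⊂ 𝒪_K` with
`𝒪_K/𝔑 ≃ ℤ/Nℤ`." Transcribed: `K` imaginary quadratic; `d_K` odd; `d_K < −3` (`d_K = −D_K`);
`2 < p`; `p` splits in `K` (`SplitsIn`: two primes of `𝓞 K` above `p`); `0 < N`; `p ∤ N`; and
(heeg) LITERALLY: an ideal `𝔑` of `𝓞 K` with `𝓞 K ⧸ 𝔑 ≃+* ZMod N`. These are the hypotheses under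
which Thm. 2.11 (the interpolation formula for `𝓛_{𝔭,ξ}(𝐟)`, the object behind the erratum's
congruence (c)) is stated; in the erratum's use `N` is the tame level `N_E/p`. A predicate; nothing
asserted. [cite: Castella2020JIMJ, §2.5 (author PDF p. 8), standing hypotheses and (heeg) (shape only; nothing asserted)] -/
def Cas20Standing (K : Type) [Field K] [NumberField K] (p N : ℕ) : Prop :=
  IsImaginaryQuadratic K ∧ Odd (NumberField.discr K) ∧ NumberField.discr K < -3 ∧
    2 < p ∧ SplitsIn K p ∧ 0 < N ∧ ¬ p ∣ N ∧
    ∃ 𝔑 : Ideal (𝓞 K), Nonempty (𝓞 K ⧸ 𝔑 ≃+* ZMod N)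

/-! ### Every erratum field at an odd `q` meets them -/

section Field

variable {W : WeierstrassCurve ℚ} [W.IsElliptic] [W.IsGloballyMinimal] {p : ℕ} [Fact p.Prime]
  {K : Type} [Field K] [NumberField K] {q : ℕ}

omit [W.IsElliptic] [W.IsGloballyMinimal] in
/-- **`d_K ≡ 1 (mod 8)` on an erratum field for an odd `q`**: the prime `2` splits in `K`
(`IsErratumField.splitsIn_two`), which for a quadratic field is `d_K ≡ 1 (mod 8)`
(`Quadratic.ncard_primesOver_two_eq_two_iff`; Marcus, *Number Fields*, Ch. 3, Thm. 25). [folklore] -/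
theorem IsErratumField.discr_emod_eight (hK : IsErratumField W K q) (hq2 : q ≠ 2) :
    NumberField.discr K % 8 = 1 :=
  (Literature.NumberTheory.QuadraticFields.Quadratic.ncard_primesOver_two_eq_two_iff hK.1.1).mp
    (hK.splitsIn_two hq2)

omit [W.IsElliptic] [W.IsGloballyMinimal] in
/-- **[Cas20, §2.5] "odd discriminant"** on an erratum field for an odd `q`. [cite: Castella2020JIMJ, §2.5 (author PDF p. 8)] -/
theorem IsErratumField.odd_discr (hK : IsErratumField W K q) (hq2 : q ≠ 2) :
    Odd (NumberField.discr K) := by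
  have h8 := hK.discr_emod_eight hq2
  rw [Int.odd_iff]
  omega

omit [W.IsElliptic] [W.IsGloballyMinimal] in
/-- **[Cas20, §2.5] "`−D_K < −3`"** on an erratum field for an odd `q`: `d_K < 0` (imaginary
quadratic, `IsImaginaryQuadratic.discr_neg`) and `d_K ≡ 1 (mod 8)` give `d_K ≤ −7 < −3`. In
particular `K ≠ ℚ(√−3), ℚ(√−1)`, so `w_K = #𝒪_K^× = 2`. [cite: Castella2020JIMJ, §2.5 (author PDF p. 8)] -/
theorem IsErratumField.discr_lt_neg_three (hK : IsErratumField W K q) (hq2 : q ≠ 2) :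
    NumberField.discr K < -3 := by
  have h8 := hK.discr_emod_eight hq2
  have hneg : NumberField.discr K < 0 :=
    Literature.NumberTheory.EllipticCurves.IsImaginaryQuadratic.discr_neg hK.1
  omega

omit [W.IsElliptic] [W.IsGloballyMinimal] in
/-- Sharper: `d_K ≤ −7` on an erratum field for an odd `q`. [folklore] -/
theorem IsErratumField.discr_le_neg_seven (hK : IsErratumField W K q) (hq2 : q ≠ 2) :
    NumberField.discr K ≤ -7 := by
  have h8 := hK.discr_emod_eight hq2
  have hneg : NumberField.discr K < 0 :=
    Literature.NumberTheory.EllipticCurves.IsImaginaryQuadratic.discr_neg hK.1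
  omega

omit [W.IsElliptic] [W.IsGloballyMinimal] in
/-- `K ≠ ℚ(√−3)` (`d_K ≠ −3`) on an erratum field for an odd `q`. [folklore] -/
theorem IsErratumField.discr_ne_neg_three (hK : IsErratumField W K q) (hq2 : q ≠ 2) :
    NumberField.discr K ≠ -3 :=
  (hK.discr_lt_neg_three hq2).ne

omit [W.IsElliptic] [W.IsGloballyMinimal] in
/-- `K ≠ ℚ(√−1)` (`d_K ≠ −4`) on an erratum field for an odd `q`. [folklore] -/
theorem IsErratumField.discr_ne_neg_four (hK : IsErratumField W K q) (hq2 : q ≠ 2) :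
    NumberField.discr K ≠ -4 := by
  have := hK.discr_le_neg_seven hq2
  omega

omit [W.IsGloballyMinimal] in
/-- A multiplicative prime divides the conductor (`dvd_conductorNorm_iff_not_hasGoodReductionAtPrime`,
Diamond–Shurman §8.3). [folklore] -/
theorem dvd_conductorNorm_of_mult {ℓ : ℕ} [Fact ℓ.Prime] (hℓ : Mult W ℓ) : ℓ ∣ W.conductorNorm ℤ :=
  (W.dvd_conductorNorm_iff_not_hasGoodReductionAtPrime ℓ).mpr
    (WeierstrassCurve.HasMultiplicativeReduction.not_hasGoodReduction (R := ℤ_[ℓ]) hℓ)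

omit [W.IsGloballyMinimal] in
/-- **The tame level `N_E/p` is positive** at a multiplicative `p` (`N_E = p · (N_E/p) ≥ 1`). [folklore] -/
theorem tameLevel_pos (hmult : Mult W p) : 0 < W.conductorNorm ℤ / p := by
  have hpP : p.Prime := Fact.out
  have hN0 : 0 < W.conductorNorm ℤ := W.conductorNorm_pos_holds
  exact Nat.div_pos (Nat.le_of_dvd hN0 (dvd_conductorNorm_of_mult hmult)) hpP.pos

omit [W.IsGloballyMinimal] in
/-- **"`N` prime to `p`" for the tame level: `p ∤ N_E/p`** at a multiplicative `p` (`p ∥ N_E`).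
[cite: Silverman1994, IV.10.2(b)] -/
theorem not_dvd_tameLevel (hmult : Mult W p) : ¬ p ∣ W.conductorNorm ℤ / p := by
  intro h
  have hpN : p ∣ W.conductorNorm ℤ := dvd_conductorNorm_of_mult hmult
  apply not_sq_dvd_conductorNorm_of_mult W p hmult
  rw [pow_two, ← Nat.div_mul_cancel hpN]
  exact Nat.mul_dvd_mul_right h p

/-- **§1's "fix a prime `p ∤ 6N`" for the tame level**: `p ∤ 6 · (N_E/p)` on the A′-hypotheses
(`p ≥ 5` multiplicative). [cite: Castella2020JIMJ, §1 (author PDF p. 2)] -/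
theorem ErratumHypotheses.not_dvd_six_mul_tameLevel (hE : ErratumHypotheses W p) :
    ¬ p ∣ 6 * (W.conductorNorm ℤ / p) := by
  have hpP : p.Prime := Fact.out
  have hp5 : 5 ≤ p := hE.1
  intro h
  rcases (Nat.Prime.dvd_mul hpP).mp h with h6 | hN
  · have h6' : p ≤ 6 := Nat.le_of_dvd (by norm_num) h6
    interval_cases p <;> simp_all (config := {decide := true})
  · exact not_dvd_tameLevel hE.2.1 hN

omit [W.IsGloballyMinimal] in
/-- **(heeg) of [Cas20, §2.5] LITERALLY, at the tame level `N_E/p`, on an erratum field**: for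
`(E, p)` with multiplicative `p`, a multiplicative `q ≠ p`, and an erratum field `K` for `q`, there
is an ideal `𝔑 ⊂ 𝓞 K` with `𝓞 K ⧸ 𝔑 ≃+* ℤ/(N_E/p)ℤ`. Every prime `ℓ ∣ N_E/p` divides `N_E`; if
`ℓ ≠ q` it splits in `K` (erratum-field clause), and `q` is ramified (`q ∣ d_K`) with `q² ∤ N_E`
(`q` multiplicative) — Castella's "every prime `q ∣ N` is either split or ramified in `K`, with
`q² ∤ N` in the latter case" — whence the ideal by
`HeegnerIdeal.exists_ideal_quotient_ringEquiv_zmod_of_split_or_ramified`.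
[cite: Castella2020JIMJ, §2.5 (author PDF p. 8), hypothesis (heeg) and the sentence following it] -/
theorem IsErratumField.heeg_tameLevel (hmult : Mult W p) [Fact q.Prime] (hmq : Mult W q)
    (hK : IsErratumField W K q) :
    ∃ 𝔑 : Ideal (𝓞 K), Nonempty (𝓞 K ⧸ 𝔑 ≃+* ZMod (W.conductorNorm ℤ / p)) := by
  have hpN : p ∣ W.conductorNorm ℤ := dvd_conductorNorm_of_mult hmult
  refine HeegnerIdeal.exists_ideal_quotient_ringEquiv_zmod_of_split_or_ramified hK.1.1
    (tameLevel_pos hmult).ne' fun ℓ hℓ hℓN ↦ ?_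
  have hℓNE : ℓ ∣ W.conductorNorm ℤ := hℓN.trans (Nat.div_dvd_of_dvd hpN)
  by_cases hℓq : ℓ = q
  · subst hℓq
    refine Or.inr ⟨hK.2.1, fun h ↦ not_sq_dvd_conductorNorm_of_mult W ℓ hmq ?_⟩
    exact h.trans (Nat.div_dvd_of_dvd hpN)
  · exact Or.inl (hK.2.2.1 ℓ hℓ hℓNE hℓq)

/-- **Every erratum field at an odd `q` meets ALL standing hypotheses of [Cas20, §2.5] at the tame
level `N_E/p`.** For `(E, p)` on the A′-hypotheses (`p ≥ 5` multiplicative, …), a multiplicative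
prime `q ∉ {2, p}`, and an erratum field `K` for `q`: `Cas20Standing K p (N_E/p)` — `K` imaginary
quadratic, `d_K` odd and `< −3`, `p > 2` split in `K`, `N_E/p > 0` prime to `p`, and (heeg) at
`N_E/p`. So on route R1's `ChainLocus ∩ {an odd non-split ramified q}` the input (c) = [Cas20,
Thm. 2.11] is invoked INSIDE its printed standing hypotheses; no class-number condition exists
on the version of record. [cite: Castella2020JIMJ, §2.5 (author PDF p. 8) and Thm. 2.11 (p. 12)]
[cite: Castella2018Erratum, Thm. 1.1 and proof (p. 4) (c)] -/
theorem IsErratumField.cas20Standing (hE : ErratumHypotheses W p) [Fact q.Prime] (hqp : q ≠ p)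
    (hq2 : q ≠ 2) (hmq : Mult W q) (hK : IsErratumField W K q) :
    Cas20Standing K p (W.conductorNorm ℤ / p) :=
  ⟨hK.1, hK.odd_discr hq2, hK.discr_lt_neg_three hq2, by have := hE.1; omega,
    hK.splitsIn_of_mult hE.2.1 (Ne.symm hqp), tameLevel_pos hE.2.1, not_dvd_tameLevel hE.2.1,
    hK.heeg_tameLevel hE.2.1 hmq⟩

end Field


end Summit.BirchSwinnertonDyer.Rank1Residual.X11b

end
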